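import Summits.CriticalPhenomena.PercolationContinuityZ3.Theorems.PercNearOneGluingNoHeavyQuantLawDecAbsorb
import HarnessLib

/-!
# QUANT lane R8, T-DEC: law-level DEC(j′) criteria, part C — CRITERION D: giant absorption plus CREDIT PAIRS into the mids of the
# remainder (explicit flows), the remaining mid mass standing alone

builds on p205010 (kernel theorem, internal audit signed; external expert review pending)

Support file (`--supports stmt-CriticalPhenomena-4575`), QUANT lane seat prim-quant-census-2 (gen 52), rung R8 of
`run/shared/lean/prim/quant/LADDER.md`; continues `…QuantLawDecAbsorb` (CORE `LawDec.decAt_of_absorb`, criterion E) and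
`…QuantLawDecAbsorbTA` (criterion C′).  Memo `run/shared/lean/prim/quant/prim-quant-census-2-g52/DEC-CRITERIA-G52.md`.  Theorems only.

* `LawDec.validAt_creditPair` — the pair `{ℓ, m; γ}` into a mid `m ≤ j′` at its minimal credit gate `γ = max(ρ, x² + (1−x)ρ)`,
  `ρ = (T − 2ℓ)/(m − ℓ)`, is valid (rule (N)): heavy `γ ≥ ρ`, light `(γ − x²)/(1−x) ≥ ρ`.
* `LawDec.rest_of_flows` — remainder data from EXPLICIT FLOWS: `ν` on `{0..j′}`; low atoms (`2h < T`) send all their mass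
  through pairs `(l, m)` (flow `u l m ≥ 0` of low mass, gate `g l m ∈ [0,1)`, each used pair valid at `(x, T, j′)`), every other atom `h`
  receives at most its mass (`Σ_l g·u/(1−g) ≤ ν h`) and keeps the rest as a self-sufficient point mass (`2h ≥ T`).
* **`LawDec.decAt_of_absorb_flows` — CRITERION D**: CORE (giants absorb `f` at gate `x`) + `rest_of_flows` on `μ − f` ⟹
  `Quant.LawDec.DECAt x j′ M μ`.  With the canonical split (giants take the smallest atoms) and ONE residual low atom this is the flat
  dual `(N1)` of DEC-TAMP-G50 §3.4; census (memo §2): E ∨ C′ ∨ D certifies EVERY heavy blob system tested (184 550 instances k ≤ 3,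
  gates k/12, sizes ≤ 5; 348 203 instances k ≤ 4, gates k/8, sizes ≤ 4; kit census in the memo), D being needed 8 times.

[this work]; DEC rules ARCH-TREES-G49 §2.2 / DEC-TAMP-G50 §3.1 (this lane).  The gluing rows served
[cite: KozmaNitzan2024, Conjecture 3 (p. 15)]; product measure [cite: Grimmett1999, §1.3 p. 10].
-/

noncomputable section

namespace Summit.CriticalPhenomena.PercolationContinuityZ3.Theorems

namespace Quant

open Finset

/-- the two-point law `{lo, hi; g}` (as in `…QuantLawDEC`) -/
local notation3 "TP[" lo ", " hi ", " g ", " h "]" =>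
  (g : ℝ) * (if (h : ℕ) = (hi : ℕ) then (1 : ℝ) else 0) + (1 - (g : ℝ)) * (if (h : ℕ) = (lo : ℕ) then (1 : ℝ) else 0)

namespace LawDec

/-- **The minimal credit gate is valid.**  For `ℓ < m ≤ j′`, `ρ = (T − 2ℓ)/(m − ℓ)`, `γ = max(ρ, x² + (1−x)ρ)` and `x < 1`, the pair
`{ℓ, m; γ}` satisfies rule (N): credit `2ℓ + (m − ℓ)·κ_x(γ) ≥ T`. [this work] -/
theorem validAt_creditPair (x T ρ γ : ℝ) (j' l m : ℕ) (hlm : l < m) (hmj : m ≤ j') (hx1 : x < 1)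
    (hρ : ρ = (T - 2 * (l : ℝ)) / ((m : ℝ) - l)) (hγ : γ = max ρ (x ^ 2 + (1 - x) * ρ)) :
    ValidAt x T j' l m γ := by
  refine Or.inr (Or.inr ⟨hlm, hmj, ?_⟩)
  have hml : (0 : ℝ) < (m : ℝ) - l := by
    have : (l : ℝ) < m := by exact_mod_cast hlm
    linarith
  have hρT : ((m : ℝ) - l) * ρ = T - 2 * (l : ℝ) := by rw [hρ, mul_div_cancel₀ _ hml.ne']
  have hrate : ρ ≤ (if x ≤ γ then γ else (γ - x ^ 2) / (1 - x)) := by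
    split_ifs with hxγ
    · rw [hγ]; exact le_max_left _ _
    · have h1x : 0 < 1 - x := by linarith
      rw [le_div_iff₀ h1x]
      have : x ^ 2 + (1 - x) * ρ ≤ γ := by rw [hγ]; exact le_max_right _ _
      linarith
  have := mul_le_mul_of_nonneg_left hrate hml.le
  linarith

/-- **Remainder data from explicit flows into the mids.**  `ν` on `{0..j′}`; flows `u l m ≥ 0` with gates `g l m ∈ [0,1)`;
a used pair (`u l m > 0`) has `l < m ≤ j′`, starts at a LOW atom (`2l < T`), ends at a non-low one (`2m ≥ T`) and is valid at
`(x, T, j′)`; every low atom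
`l ≤ j′` is fully shipped (`Σ_m u l m = ν l`); every atom `h ≤ j′` that is not low receives at most its mass
(`Σ_l g·u/(1−g) ≤ ν h`).  Then `(ν)·1_{≤ j′}` is an exact mixture of components valid at `(x, T, j′)`. [this work] -/
theorem rest_of_flows (x T : ℝ) (j' : ℕ) (ν : ℕ → ℝ) (u g : ℕ → ℕ → ℝ)
    (hu0 : ∀ l m, 0 ≤ u l m) (hg : ∀ l m, 0 ≤ g l m ∧ g l m < 1)
    (huse : ∀ l m, 0 < u l m → l < m ∧ m ≤ j' ∧ 2 * (l : ℝ) < T ∧ T ≤ 2 * (m : ℝ) ∧ ValidAt x T j' l m (g l m))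
    (hlow : ∀ l, l ≤ j' → 2 * (l : ℝ) < T → ∑ m ∈ Finset.range (j' + 1), u l m = ν l)
    (hcap : ∀ h, h ≤ j' → T ≤ 2 * (h : ℝ) →
      ∑ l ∈ Finset.range (j' + 1), g l h * (u l h / (1 - g l h)) ≤ ν h) :
    ∃ (ρ : Type) (_ : Fintype ρ) (lam gg : ρ → ℝ) (lo hi : ρ → ℕ),
      (∀ r, 0 ≤ lam r) ∧ (∑ r, lam r = ∑ h ∈ Finset.range (j' + 1), ν h) ∧ (∀ r, 0 ≤ gg r ∧ gg r ≤ 1) ∧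
      (∀ r, lo r ≤ hi r) ∧ (∀ r, hi r ≤ j') ∧
      (∀ h, (if h ≤ j' then ν h else 0) = ∑ r, lam r * TP[lo r, hi r, gg r, h]) ∧
      (∀ r, 0 < lam r → ValidAt x T j' (lo r) (hi r) (gg r)) := by
  classical
  -- pair weights and point weights
  have hw0 : ∀ l m, 0 ≤ u l m / (1 - g l m) := fun l m => div_nonneg (hu0 l m) (by linarith [(hg l m).2])
  have hu_zero : ∀ l m, ¬ (l < m ∧ m ≤ j' ∧ 2 * (l : ℝ) < T ∧ T ≤ 2 * (m : ℝ)) → u l m = 0 := by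
    intro l m hn
    by_contra hne
    exact hn (let h := huse l m (lt_of_le_of_ne (hu0 l m) (Ne.symm hne)); ⟨h.1, h.2.1, h.2.2.1, h.2.2.2.1⟩)
  -- point weight at h: ν h − received mass if h is not low, 0 if h is low
  refine ⟨(Fin (j' + 1) × Fin (j' + 1)) ⊕ Fin (j' + 1), inferInstance,
    Sum.elim (fun p => u p.1 p.2 / (1 - g p.1 p.2))
      (fun h => if 2 * ((h : ℕ) : ℝ) < T then 0 else ν h - ∑ l ∈ Finset.range (j' + 1), g l h * (u l h / (1 - g l h))),
    Sum.elim (fun p => g p.1 p.2) (fun _ => 1),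
    Sum.elim (fun p => min (p.1 : ℕ) p.2) (fun h => (h : ℕ)), Sum.elim (fun p => (p.2 : ℕ)) (fun h => (h : ℕ)),
    ?_, ?_, ?_, ?_, ?_, ?_, ?_⟩
  · rintro (p | h)
    · exact hw0 _ _
    · dsimp only [Sum.elim_inr]
      split_ifs with hlow'
      · exact le_rfl
      · exact sub_nonneg.2 (hcap h (Nat.lt_succ_iff.1 h.isLt) (not_lt.1 hlow'))
  · -- total weight: Σ pairs + Σ points = Σ ν
    rw [Fintype.sum_sum_type, Fintype.sum_prod_type]
    show (∑ p₁ : Fin (j' + 1), ∑ p₂ : Fin (j' + 1), u (p₁ : ℕ) (p₂ : ℕ) / (1 - g (p₁ : ℕ) (p₂ : ℕ))) +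
      ∑ h : Fin (j' + 1), (if 2 * ((h : ℕ) : ℝ) < T then 0 else
        ν h - ∑ l ∈ Finset.range (j' + 1), g l h * (u l h / (1 - g l h))) = ∑ h ∈ Finset.range (j' + 1), ν h
    rw [Fin.sum_univ_eq_sum_range (fun l => ∑ p₂ : Fin (j' + 1), u l (p₂ : ℕ) / (1 - g l (p₂ : ℕ))) (j' + 1)]
    rw [Fin.sum_univ_eq_sum_range (fun h => if 2 * (h : ℝ) < T then (0 : ℝ) else
        ν h - ∑ l ∈ Finset.range (j' + 1), g l h * (u l h / (1 - g l h))) (j' + 1)]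
    have e1 : ∀ l, (∑ p₂ : Fin (j' + 1), u l (p₂ : ℕ) / (1 - g l (p₂ : ℕ))) =
        ∑ m ∈ Finset.range (j' + 1), u l m / (1 - g l m) := fun l =>
      Fin.sum_univ_eq_sum_range (fun m => u l m / (1 - g l m)) (j' + 1)
    simp only [e1]
    -- split each pair weight into its low part and its high part
    have e2 : ∀ l m, u l m / (1 - g l m) = u l m + g l m * (u l m / (1 - g l m)) := by
      intro l m
      have h1 : (1 - g l m) ≠ 0 := by linarith [(hg l m).2]
      field_simp
      ring
    rw [Finset.sum_congr rfl (fun l _ => Finset.sum_congr rfl (fun m _ => e2 l m))]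
    simp only [Finset.sum_add_distrib]
    rw [Finset.sum_comm (f := fun l m => g l m * (u l m / (1 - g l m)))]
    rw [← Finset.sum_add_distrib, ← Finset.sum_add_distrib]
    refine Finset.sum_congr rfl fun h hh => ?_
    have hhj : h ≤ j' := Nat.lt_succ_iff.1 (Finset.mem_range.1 hh)
    by_cases hlow' : 2 * (h : ℝ) < T
    · rw [if_pos hlow', hlow h hhj hlow', add_zero]
      have : ∑ l ∈ Finset.range (j' + 1), g l h * (u l h / (1 - g l h)) = 0 := by
        refine Finset.sum_eq_zero fun l _ => ?_
        rw [hu_zero l h (fun hc => by linarith [hc.2.2.2]), zero_div, mul_zero]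
      rw [this, add_zero]
    · rw [if_neg hlow']
      have : ∑ m ∈ Finset.range (j' + 1), u h m = 0 :=
        Finset.sum_eq_zero fun m _ => hu_zero h m (fun hc => hlow' hc.2.2.1)
      rw [this]; ring
  · rintro (p | h)
    · exact ⟨(hg _ _).1, (hg _ _).2.le⟩
    · exact ⟨zero_le_one, le_rfl⟩
  · rintro (p | h)
    · exact min_le_right _ _
    · exact le_rfl
  · rintro (p | h)
    · exact Nat.lt_succ_iff.1 p.2.isLt
    · exact Nat.lt_succ_iff.1 h.isLt
  · -- mixture identity
    intro t
    rw [Fintype.sum_sum_type, Fintype.sum_prod_type]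
    show (if t ≤ j' then ν t else 0) =
      (∑ p₁ : Fin (j' + 1), ∑ p₂ : Fin (j' + 1),
        u (p₁ : ℕ) (p₂ : ℕ) / (1 - g (p₁ : ℕ) (p₂ : ℕ)) * TP[min (p₁ : ℕ) (p₂ : ℕ), (p₂ : ℕ), g (p₁ : ℕ) (p₂ : ℕ), t]) +
      ∑ h : Fin (j' + 1), (if 2 * ((h : ℕ) : ℝ) < T then 0 else
        ν h - ∑ l ∈ Finset.range (j' + 1), g l h * (u l h / (1 - g l h))) * TP[(h : ℕ), (h : ℕ), (1 : ℝ), t]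
    rw [Fin.sum_univ_eq_sum_range (fun l => ∑ p₂ : Fin (j' + 1),
        u l (p₂ : ℕ) / (1 - g l (p₂ : ℕ)) * TP[min l (p₂ : ℕ), (p₂ : ℕ), g l (p₂ : ℕ), t]) (j' + 1)]
    rw [Fin.sum_univ_eq_sum_range (fun h => (if 2 * (h : ℝ) < T then (0 : ℝ) else
        ν h - ∑ l ∈ Finset.range (j' + 1), g l h * (u l h / (1 - g l h))) * TP[h, h, (1 : ℝ), t]) (j' + 1)]
    have e1 : ∀ l, (∑ p₂ : Fin (j' + 1), u l (p₂ : ℕ) / (1 - g l (p₂ : ℕ)) * TP[min l (p₂ : ℕ), (p₂ : ℕ), g l (p₂ : ℕ), t]) =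
        ∑ m ∈ Finset.range (j' + 1), u l m / (1 - g l m) * TP[min l m, m, g l m, t] := fun l =>
      Fin.sum_univ_eq_sum_range (fun m => u l m / (1 - g l m) * TP[min l m, m, g l m, t]) (j' + 1)
    simp only [e1]
    -- used pairs have `min l m = l`; unused ones have weight 0
    have e2 : ∀ l m, u l m / (1 - g l m) * TP[min l m, m, g l m, t]
        = (g l m * (u l m / (1 - g l m))) * (if t = m then (1 : ℝ) else 0) + u l m * (if t = l then (1 : ℝ) else 0) := by
      intro l m
      have h1 : (1 - g l m) ≠ 0 := by linarith [(hg l m).2]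
      rcases (hu0 l m).eq_or_lt with hz | hpos
      · rw [← hz]; simp
      · rw [min_eq_left (huse l m hpos).1.le]
        have hk : u l m / (1 - g l m) * (1 - g l m) = u l m := div_mul_cancel₀ _ h1
        calc u l m / (1 - g l m) * TP[l, m, g l m, t]
            = (g l m * (u l m / (1 - g l m))) * (if t = m then (1 : ℝ) else 0)
              + (u l m / (1 - g l m) * (1 - g l m)) * (if t = l then (1 : ℝ) else 0) := by ring
          _ = _ := by rw [hk]
    rw [Finset.sum_congr rfl (fun l _ => Finset.sum_congr rfl (fun m _ => e2 l m))]
    simp only [Finset.sum_add_distrib]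
    rw [Finset.sum_comm (f := fun l m => (g l m * (u l m / (1 - g l m))) * (if t = m then (1 : ℝ) else 0))]
    simp only [← Finset.sum_mul]
    rw [sum_indicator (fun m => ∑ l ∈ Finset.range (j' + 1), g l m * (u l m / (1 - g l m))) (j' + 1) t]
    rw [sum_indicator (fun l => ∑ m ∈ Finset.range (j' + 1), u l m) (j' + 1) t]
    have e4 : ∀ h : ℕ, (if 2 * (h : ℝ) < T then (0 : ℝ) else
        ν h - ∑ l ∈ Finset.range (j' + 1), g l h * (u l h / (1 - g l h))) * TP[h, h, (1 : ℝ), t]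
        = (if 2 * (h : ℝ) < T then (0 : ℝ) else
          ν h - ∑ l ∈ Finset.range (j' + 1), g l h * (u l h / (1 - g l h))) * (if t = h then (1 : ℝ) else 0) := by
      intro h; ring
    simp only [e4]
    rw [sum_indicator (fun h => if 2 * (h : ℝ) < T then (0 : ℝ) else
        ν h - ∑ l ∈ Finset.range (j' + 1), g l h * (u l h / (1 - g l h))) (j' + 1) t]
    by_cases ht : t ≤ j'
    · rw [if_pos ht, if_pos (Nat.lt_succ_of_le ht), if_pos (Nat.lt_succ_of_le ht), if_pos (Nat.lt_succ_of_le ht)]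
      by_cases hlow' : 2 * (t : ℝ) < T
      · rw [if_pos hlow', hlow t ht hlow']
        have : ∑ l ∈ Finset.range (j' + 1), g l t * (u l t / (1 - g l t)) = 0 := by
          refine Finset.sum_eq_zero fun l _ => ?_
          rw [hu_zero l t (fun hc => by linarith [hc.2.2.2]), zero_div, mul_zero]
        rw [this]; ring
      · rw [if_neg hlow']
        have : ∑ m ∈ Finset.range (j' + 1), u t m = 0 :=
          Finset.sum_eq_zero fun m _ => hu_zero t m (fun hc => hlow' hc.2.2.1)
        rw [this]; ring
    · rw [if_neg ht, if_neg (by omega), if_neg (by omega), if_neg (by omega)]; ring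
  · -- validity
    rintro (p | h) hpos
    · dsimp only [Sum.elim_inl] at hpos ⊢
      have hu : 0 < u p.1 p.2 := by
        by_contra hle
        have : u p.1 p.2 = 0 := le_antisymm (not_lt.1 hle) (hu0 _ _)
        rw [this, zero_div] at hpos
        exact lt_irrefl _ hpos
      rw [min_eq_left (huse _ _ hu).1.le]
      exact (huse _ _ hu).2.2.2.2
    · dsimp only [Sum.elim_inr] at hpos ⊢
      refine Or.inl ⟨rfl, Or.inl ?_⟩
      by_contra hlt
      rw [if_pos (not_le.1 hlt)] at hpos
      exact lt_irrefl _ hpos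

/-- **CRITERION D (giant absorption at the floor gate + credit pairs into the mids).**  Law `μ` on `{0..M}` (mean `T`), floor
`0 < x < 1`, layer `j′ < M`, absorbed masses `f ≥ 0` balancing the giants at gate `x`, and flows `u` with gates `g` for the
remainder `μ − f` as in `rest_of_flows`.  Then `Quant.LawDec.DECAt x j′ M μ`. [this work] -/
theorem decAt_of_absorb_flows (x : ℝ) (j' M : ℕ) (μ f : ℕ → ℝ) (u g : ℕ → ℕ → ℝ) (hjM : j' < M)
    (hμ0 : ∀ h, 0 ≤ μ h) (hμM : ∀ h, M < h → μ h = 0) (hμ1 : ∑ h ∈ Finset.range (M + 1), μ h = 1)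
    (hx0 : 0 < x) (hx1 : x < 1) (hf0 : ∀ h, 0 ≤ f h)
    (hbal : x * ∑ h ∈ Finset.range (j' + 1), f h = (1 - x) * ∑ h ∈ Finset.Ico (j' + 1) (M + 1), μ h)
    (hu0 : ∀ l m, 0 ≤ u l m) (hg : ∀ l m, 0 ≤ g l m ∧ g l m < 1)
    (huse : ∀ l m, 0 < u l m → l < m ∧ m ≤ j' ∧ 2 * (l : ℝ) < (∑ k ∈ Finset.range (M + 1), (k : ℝ) * μ k) ∧
      (∑ k ∈ Finset.range (M + 1), (k : ℝ) * μ k) ≤ 2 * (m : ℝ) ∧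
      ValidAt x (∑ k ∈ Finset.range (M + 1), (k : ℝ) * μ k) j' l m (g l m))
    (hlow : ∀ l, l ≤ j' → 2 * (l : ℝ) < (∑ k ∈ Finset.range (M + 1), (k : ℝ) * μ k) →
      ∑ m ∈ Finset.range (j' + 1), u l m = μ l - f l)
    (hcap : ∀ h, h ≤ j' → (∑ k ∈ Finset.range (M + 1), (k : ℝ) * μ k) ≤ 2 * (h : ℝ) →
      ∑ l ∈ Finset.range (j' + 1), g l h * (u l h / (1 - g l h)) ≤ μ h - f h) :
    DECAt x j' M μ :=
  decAt_of_absorb x x j' M μ f hjM hμ0 hμM hμ1 le_rfl hx0 hx1 hf0 hbal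
    (rest_of_flows x _ j' (fun h => μ h - f h) u g hu0 hg huse hlow hcap)

end LawDec

end Quant

end Summit.CriticalPhenomena.PercolationContinuityZ3.Theorems
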